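import Mathlib.Analysis.SpecialFunctions.Log.NegMulLog
import Mathlib.Analysis.SpecialFunctions.Integrals.Basic
import Mathlib.MeasureTheory.Integral.IntervalIntegral.FundThmCalculus
import Mathlib.Analysis.Asymptotics.Defs
import HarnessLib

/-!
# Super-exponential decay from a delay inequality (Greaves, Lemmas 4.2.7–4.2.9)

Trunk `AntSieve` (topic `NumberTheory/Sieve`). In Iwaniec's treatment of the Rosser–Iwaniec
`β`-sieve the differences `Q = F − f` and `P − 2 = F + f − 2` of the sieve functions are shown
to be `O(e^{−s log s})` from the vanishing of their inner products with the adjoint functions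
`q`, `p`: the inner-product identities give `s |U(s)| ≤ M ∫_{s−1}^{s} |U(x)| dx` for large `s`,
and any continuous `U` obeying such a delay inequality decays super-exponentially
[Greaves2001, Lemma 4.2.7]. The proof in [Greaves2001] goes through two auxiliary lemmas:
Lemma 4.2.8 (a weighted estimate with the convex weight `φ(x) = x log x − N x`) and Lemma 4.2.9
(a "continuous induction": `u(s) < 1/2 + (1/2) sup_{[s−1, s]} u` for `s > s₀` and `u` bounded on
`[s₀ − 1, s₀]` force `u` bounded). This file proves the three lemmas (with `N = 0` in
Lemma 4.2.8, which is all that Lemma 4.2.7 uses), in the continuous case.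

## Main results

* `bounded_of_forall_lt_half_add_half` — [Greaves2001, Lemma 4.2.9] for continuous `u`
  (the supremum hypothesis is phrased through arbitrary upper bounds `K` of `u` on `[s − 1, s]`).
* `mul_log_sub_mul_log_le` — the convexity inequality `s log s − x log x ≤ (s − x)(log s + 1)`
  behind [Greaves2001, Lemma 4.2.8].
* `integral_abs_le_of_weighted_bound` — [Greaves2001, Lemma 4.2.8] with `N = 0`.
* `isBigO_exp_neg_mul_log_of_delay_ineq` — [Greaves2001, Lemma 4.2.7]: `U ≪ e^{−s log s}`;
  `isBigO_exp_neg_of_delay_ineq` — the weaker `U ≪ e^{−s}` used for the normalisation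
  `F, f = 1 + O(e^{−s})` of the `β`-sieve functions (`IsBetaSieveSolution`).

## References

* [Greaves2001] G. Greaves, *Sieves in Number Theory*, Springer (2001), §4.2.4, Lemmas 4.2.6–4.2.9
  and their proofs (pp. 91–92 of the printed book).
-/

open Filter Asymptotics Set Topology MeasureTheory

noncomputable section

namespace Literature.NumberTheory.Sieve

/-! ### [Greaves2001, Lemma 4.2.9]: continuous induction -/

/-- **[Greaves2001, Lemma 4.2.9]** (continuous case). Let `u` be continuous on `[s₁ − 1, ∞)`,
bounded by `A > 1` on `[s₁ − 1, s₁]`, and suppose that for every `s ≥ s₁` and every upper bound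
`K` of `u` on `[s − 1, s]` one has `u(s) < 1/2 + K/2` (i.e. `u(s) < 1/2 + (1/2) sup_{[s−1,s]} u`).
Then `u ≤ A` on `[s₁ − 1, ∞)`. (Proof as printed: if not, the infimum `s*` of the bad points has
`u(s*) = A` by continuity and `u ≤ A` on `[s* − 1, s*]`, so `A < 1/2 + A/2`, i.e. `A < 1`.)
[cite: Greaves2001, Lemma 4.2.9] -/
theorem bounded_of_forall_lt_half_add_half {u : ℝ → ℝ} {s₁ A : ℝ} (hA : 1 < A)
    (hu : ContinuousOn u (Ici (s₁ - 1))) (h0 : ∀ x ∈ Icc (s₁ - 1) s₁, u x ≤ A)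
    (hstep : ∀ s, s₁ ≤ s → ∀ K : ℝ, (∀ x ∈ Icc (s - 1) s, u x ≤ K) → u s < 1 / 2 + K / 2) :
    ∀ s, s₁ - 1 ≤ s → u s ≤ A := by
  by_contra hneg
  simp only [not_forall, not_le, exists_prop] at hneg
  obtain ⟨t₀, ht₀, ht₀A⟩ := hneg
  -- the set of bad points at or beyond `s₁`
  set T : Set ℝ := {t | s₁ ≤ t ∧ A < u t} with hT
  have ht₀T : t₀ ∈ T := by
    refine ⟨?_, ht₀A⟩
    by_contra hlt
    exact absurd (h0 t₀ ⟨ht₀, (not_le.mp hlt).le⟩) (not_le.mpr ht₀A)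
  have hTne : T.Nonempty := ⟨t₀, ht₀T⟩
  have hTbdd : BddBelow T := ⟨s₁, fun t ht => ht.1⟩
  set c : ℝ := sInf T with hc
  have hc₁ : s₁ ≤ c := le_csInf hTne fun t ht => ht.1
  have hcle : ∀ t ∈ T, c ≤ t := fun t ht => csInf_le hTbdd ht
  -- `u ≤ A` strictly to the left of `c`
  have hleft : ∀ y, s₁ - 1 ≤ y → y < c → u y ≤ A := by
    intro y hy hyc
    by_cases hy₁ : y ≤ s₁
    · exact h0 y ⟨hy, hy₁⟩
    · by_contra hAy
      exact absurd (hcle y ⟨(not_le.mp hy₁).le, not_le.mp hAy⟩) (not_le.mpr hyc)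
  have hcS : c ∈ Ici (s₁ - 1) := show s₁ - 1 ≤ c by linarith
  have hcont := Metric.continuousWithinAt_iff.mp (hu c hcS)
  -- `u c ≤ A`
  have hucle : u c ≤ A := by
    by_contra hAc
    rw [not_le] at hAc
    rcases hc₁.eq_or_lt with h | h
    · rw [← h] at hAc
      exact absurd (h0 s₁ ⟨by linarith, le_rfl⟩) (not_le.mpr hAc)
    · obtain ⟨δ, hδ, hδu⟩ := hcont (u c - A) (by linarith)
      set y : ℝ := max s₁ (c - δ / 2) with hy
      have hy₁ : s₁ ≤ y := le_max_left _ _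
      have hyc : y < c := max_lt h (by linarith)
      have hyδ : dist y c < δ := by
        rw [Real.dist_eq, abs_of_neg (by linarith)]
        have : c - δ / 2 ≤ y := le_max_right _ _
        linarith
      have hclose := hδu (show y ∈ Ici (s₁ - 1) from show s₁ - 1 ≤ y by linarith) hyδ
      rw [Real.dist_eq] at hclose
      have hAy : A < u y := by
        have := (abs_lt.mp hclose).1
        linarith
      exact absurd (hcle y ⟨hy₁, hAy⟩) (not_le.mpr hyc)
  -- `A ≤ u c`
  have hAuc : A ≤ u c := by
    by_contra hcA
    rw [not_le] at hcA
    obtain ⟨δ, hδ, hδu⟩ := hcont (A - u c) (by linarith)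
    obtain ⟨t, htT, htδ⟩ := exists_lt_of_csInf_lt hTne (show c < c + δ by linarith)
    have hct : c ≤ t := hcle t htT
    have hdist : dist t c < δ := by
      rw [Real.dist_eq, abs_of_nonneg (by linarith)]
      linarith
    have hclose := hδu (show t ∈ Ici (s₁ - 1) from show s₁ - 1 ≤ t by linarith [htT.1]) hdist
    rw [Real.dist_eq] at hclose
    have := (abs_lt.mp hclose).2
    linarith [htT.2]
  -- the step hypothesis at `c` with `K = A`
  have hK : ∀ x ∈ Icc (c - 1) c, u x ≤ A := by
    intro x hx
    rcases hx.2.eq_or_lt with h | h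
    · rw [h]; exact hucle
    · exact hleft x (by linarith [hx.1]) h
  have := hstep c hc₁ A hK
  linarith

/-! ### [Greaves2001, Lemma 4.2.8] with `N = 0`: the weight `φ(x) = x log x` -/

/-- The convexity inequality for `φ(x) = x log x`: `φ(s) − φ(x) ≤ (s − x) φ'(s)` with
`φ'(s) = log s + 1`, for `0 ≤ x ≤ s` (used in the proof of [Greaves2001, Lemma 4.2.8]; it
reduces to `log (s/x) ≤ s/x − 1`). [cite: Greaves2001, proof of Lemma 4.2.8] -/
theorem mul_log_sub_mul_log_le {x s : ℝ} (hx : 0 ≤ x) (hxs : x ≤ s) :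
    s * Real.log s - x * Real.log x ≤ (s - x) * (Real.log s + 1) := by
  rcases hx.eq_or_lt with h | h
  · rw [← h]; simp only [zero_mul, sub_zero]; nlinarith [hxs, h]
  · have hs : 0 < s := h.trans_le hxs
    have hlog : Real.log (s / x) ≤ s / x - 1 := Real.log_le_sub_one_of_pos (div_pos hs h)
    rw [Real.log_div hs.ne' h.ne'] at hlog
    have hmul := mul_le_mul_of_nonneg_left hlog h.le
    have hsx : x * (s / x - 1) = s - x := by field_simp
    rw [hsx] at hmul
    nlinarith [hmul]

/-- The elementary integral `∫_{s−1}^{s} e^{(s−x)L} dx = (e^L − 1)/L` (`L ≠ 0`). [folklore] -/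
theorem integral_exp_mul_sub (s L : ℝ) (hL : L ≠ 0) :
    ∫ x in (s - 1)..s, Real.exp ((s - x) * L) = (Real.exp L - 1) / L := by
  have hderiv : ∀ x ∈ uIcc (s - 1) s,
      HasDerivAt (fun x : ℝ => -Real.exp ((s - x) * L) / L) (Real.exp ((s - x) * L)) x := by
    intro x _
    have h1 : HasDerivAt (fun x : ℝ => (s - x) * L) (-L) x := by
      simpa using ((hasDerivAt_id x).const_sub s).mul_const L
    have h2 := (h1.exp).neg.div_const L
    refine h2.congr_deriv ?_
    field_simp
  rw [intervalIntegral.integral_eq_sub_of_hasDerivAt hderiv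
    ((Continuous.continuousOn (by fun_prop)).intervalIntegrable)]
  simp only [sub_self, zero_mul, Real.exp_zero, sub_sub_cancel, one_mul]
  field_simp
  ring

/-- **[Greaves2001, Lemma 4.2.8] with `N = 0`.** Let `u(x) = |U(x)| e^{x log x}` and let `K`
bound `u` on `[s − 1, s]`, where `s ≥ 1`. Then
`∫_{s−1}^{s} |U(x)| dx ≤ K e^{−s log s} · e s / (log s + 1)`
(from `e^{−x log x} ≤ e^{−s log s} e^{(s−x)(log s + 1)}` and the elementary integral); in
particular `(M/s) ∫_{s−1}^{s} |U| ≤ (1/2) K e^{−s log s}` as soon as `log s + 1 ≥ 2eM`.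
[cite: Greaves2001, Lemma 4.2.8] -/
theorem integral_abs_le_of_weighted_bound {U : ℝ → ℝ} {s K : ℝ} (hs : 1 ≤ s)
    (hU : IntervalIntegrable (fun x => |U x|) volume (s - 1) s)
    (hK : ∀ x ∈ Icc (s - 1) s, |U x| * Real.exp (x * Real.log x) ≤ K) :
    ∫ x in (s - 1)..s, |U x| ≤
      K * Real.exp (-(s * Real.log s)) * (Real.exp 1 * s) / (Real.log s + 1) := by
  have hs0 : 0 < s := one_pos.trans_le hs
  set L : ℝ := Real.log s + 1 with hL
  have hL0 : 0 < L := by have := Real.log_nonneg hs; rw [hL]; linarith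
  have hK0 : 0 ≤ K := by
    have := hK s ⟨by linarith, le_rfl⟩
    exact le_trans (mul_nonneg (abs_nonneg _) (Real.exp_pos _).le) this
  -- pointwise bound `|U x| ≤ K e^{-φ(s)} e^{(s - x) L}`
  have hpt : ∀ x ∈ Icc (s - 1) s,
      |U x| ≤ K * Real.exp (-(s * Real.log s)) * Real.exp ((s - x) * L) := by
    intro x hx
    have hx0 : 0 ≤ x := by linarith [hx.1]
    have h1 : |U x| ≤ K * Real.exp (-(x * Real.log x)) := by
      have := hK x hx
      rw [← le_div_iff₀ (Real.exp_pos _)] at this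
      rwa [Real.exp_neg, ← div_eq_mul_inv]
    have h2 : Real.exp (-(x * Real.log x)) ≤
        Real.exp (-(s * Real.log s)) * Real.exp ((s - x) * L) := by
      rw [← Real.exp_add, Real.exp_le_exp]
      have := mul_log_sub_mul_log_le hx0 hx.2
      rw [hL]; linarith
    calc |U x| ≤ K * Real.exp (-(x * Real.log x)) := h1
      _ ≤ K * (Real.exp (-(s * Real.log s)) * Real.exp ((s - x) * L)) :=
          mul_le_mul_of_nonneg_left h2 hK0
      _ = _ := by ring
  have hint := intervalIntegral.integral_mono_on (by linarith) hU
    ((Continuous.continuousOn (by fun_prop)).intervalIntegrable) hpt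
  refine hint.trans ?_
  rw [intervalIntegral.integral_const_mul, integral_exp_mul_sub s L hL0.ne']
  have hexpL : Real.exp L = Real.exp 1 * s := by
    rw [hL, add_comm, Real.exp_add, Real.exp_log hs0]
  rw [hexpL, mul_div_assoc]
  refine mul_le_mul_of_nonneg_left ?_ (mul_nonneg hK0 (Real.exp_pos _).le)
  exact div_le_div_of_nonneg_right (by linarith) hL0.le

/-! ### [Greaves2001, Lemma 4.2.7]: super-exponential decay -/

/-- **[Greaves2001, Lemma 4.2.7].** Suppose `U` is continuous on `(s₀ − 1, ∞)` and satisfies the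
delay inequality `s |U(s)| ≤ M ∫_{s−1}^{s} |U(x)| dx` for all `s > s₀`. Then
`U(s) ≪ e^{−s log s}` as `s → ∞` (the implied constant depending on `M` and `U`).
[cite: Greaves2001, Lemma 4.2.7] -/
theorem isBigO_exp_neg_mul_log_of_delay_ineq {U : ℝ → ℝ} {s₀ M : ℝ}
    (hU : ContinuousOn U (Ioi (s₀ - 1)))
    (hM : ∀ s, s₀ < s → s * |U s| ≤ M * ∫ x in (s - 1)..s, |U x|) :
    U =O[atTop] fun s => Real.exp (-(s * Real.log s)) := by
  -- replace `M` by `M' = max M 1 > 0`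
  set M' : ℝ := max M 1 with hM'
  have hM'0 : 0 < M' := lt_of_lt_of_le one_pos (le_max_right _ _)
  have habsU : ContinuousOn (fun x => |U x|) (Ioi (s₀ - 1)) := hU.abs
  have hii : ∀ s, s₀ < s → IntervalIntegrable (fun x => |U x|) volume (s - 1) s := by
    intro s hs
    refine (habsU.mono fun x hx => ?_).intervalIntegrable
    rw [uIcc_of_le (by linarith)] at hx
    exact show s₀ - 1 < x by linarith [hx.1]
  have hM1 : ∀ s, s₀ < s → s * |U s| ≤ M' * ∫ x in (s - 1)..s, |U x| := by
    intro s hs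
    refine (hM s hs).trans (mul_le_mul_of_nonneg_right (le_max_left _ _) ?_)
    exact intervalIntegral.integral_nonneg (by linarith) fun x _ => abs_nonneg _
  -- the threshold `s₁`
  set s₁ : ℝ := max (s₀ + 1) (max 1 (Real.exp (2 * Real.exp 1 * M' - 1))) with hs₁
  have hs₁₀ : s₀ + 1 ≤ s₁ := le_max_left _ _
  have hs₁1 : 1 ≤ s₁ := (le_max_left _ _).trans (le_max_right _ _)
  have hs₁e : Real.exp (2 * Real.exp 1 * M' - 1) ≤ s₁ := (le_max_right _ _).trans (le_max_right _ _)
  -- the weighted function `u = |U| e^{φ}`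
  set u : ℝ → ℝ := fun x => |U x| * Real.exp (x * Real.log x) with hu
  have hucont : ContinuousOn u (Ici (s₁ - 1)) := by
    refine (habsU.mono fun x (hx : s₁ - 1 ≤ x) => show s₀ - 1 < x by linarith).mul ?_
    exact (Real.continuous_exp.comp Real.continuous_mul_log).continuousOn
  -- the step inequality `u s ≤ K / 2` for `s ≥ s₁`
  have hstep : ∀ s, s₁ ≤ s → ∀ K : ℝ, (∀ x ∈ Icc (s - 1) s, u x ≤ K) → u s < 1 / 2 + K / 2 := by
    intro s hs K hK
    have hs1 : 1 ≤ s := hs₁1.trans hs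
    have hs0 : 0 < s := one_pos.trans_le hs1
    have hss₀ : s₀ < s := by linarith
    have hK0 : 0 ≤ K :=
      le_trans (mul_nonneg (abs_nonneg _) (Real.exp_pos _).le) (hK s ⟨by linarith, le_rfl⟩)
    have hL : 2 * Real.exp 1 * M' ≤ Real.log s + 1 := by
      have h1 : Real.log (Real.exp (2 * Real.exp 1 * M' - 1)) ≤ Real.log s :=
        Real.log_le_log (Real.exp_pos _) (hs₁e.trans hs)
      rw [Real.log_exp] at h1
      linarith
    have hL0 : 0 < Real.log s + 1 := by linarith [Real.log_nonneg hs1]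
    have hI := integral_abs_le_of_weighted_bound hs1 (hii s hss₀) hK
    -- `|U s| ≤ M' e K e^{-φ(s)} / (log s + 1) ≤ (K/2) e^{-φ(s)}`
    have h1 : s * |U s| ≤
        M' * (K * Real.exp (-(s * Real.log s)) * (Real.exp 1 * s) / (Real.log s + 1)) :=
      (hM1 s hss₀).trans (mul_le_mul_of_nonneg_left hI hM'0.le)
    have h2 : |U s| ≤ M' * Real.exp 1 / (Real.log s + 1) * (K * Real.exp (-(s * Real.log s))) := by
      rw [← mul_le_mul_iff_of_pos_left hs0]
      refine h1.trans_eq ?_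
      field_simp
    have h3 : M' * Real.exp 1 / (Real.log s + 1) ≤ 1 / 2 := by
      rw [div_le_iff₀ hL0]; linarith
    have h4 : |U s| ≤ 1 / 2 * (K * Real.exp (-(s * Real.log s))) :=
      h2.trans (mul_le_mul_of_nonneg_right h3 (mul_nonneg hK0 (Real.exp_pos _).le))
    have h5 : u s ≤ K / 2 := by
      show |U s| * Real.exp (s * Real.log s) ≤ K / 2
      have := mul_le_mul_of_nonneg_right h4 (Real.exp_pos (s * Real.log s)).le
      refine this.trans_eq ?_
      rw [mul_assoc, mul_assoc, ← Real.exp_add, neg_add_cancel, Real.exp_zero]; ring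
    linarith
  -- a bound `A > 1` for `u` on `[s₁ - 1, s₁]`
  obtain ⟨B, hB⟩ : ∃ B : ℝ, ∀ x ∈ Icc (s₁ - 1) s₁, u x ≤ B := by
    obtain ⟨x₀, _, hx₀⟩ := (isCompact_Icc (a := s₁ - 1) (b := s₁)).exists_isMaxOn
      (nonempty_Icc.mpr (by linarith)) (hucont.mono Icc_subset_Ici_self)
    exact ⟨u x₀, fun x hx => hx₀ hx⟩
  set A : ℝ := max B 2 with hAdef
  have hA1 : 1 < A := lt_of_lt_of_le one_lt_two (le_max_right _ _)
  have hbound := bounded_of_forall_lt_half_add_half hA1 hucont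
    (fun x hx => (hB x hx).trans (le_max_left _ _)) hstep
  -- conclusion
  refine IsBigO.of_bound A ?_
  filter_upwards [eventually_ge_atTop s₁] with s hs
  have hus := hbound s (by linarith)
  rw [Real.norm_eq_abs, Real.norm_eq_abs, Real.abs_exp]
  have : |U s| * Real.exp (s * Real.log s) ≤ A := hus
  rw [Real.exp_neg, ← div_eq_mul_inv, le_div_iff₀ (Real.exp_pos _)]
  exact this

/-- **Exponential decay** (the form consumed by the normalisation `F, f = 1 + O(e^{−s})` of
`IsBetaSieveSolution`): under the hypotheses of [Greaves2001, Lemma 4.2.7], `U(s) ≪ e^{−s}`.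
[cite: Greaves2001, Lemma 4.2.7] -/
theorem isBigO_exp_neg_of_delay_ineq {U : ℝ → ℝ} {s₀ M : ℝ}
    (hU : ContinuousOn U (Ioi (s₀ - 1)))
    (hM : ∀ s, s₀ < s → s * |U s| ≤ M * ∫ x in (s - 1)..s, |U x|) :
    U =O[atTop] fun s => Real.exp (-s) := by
  refine (isBigO_exp_neg_mul_log_of_delay_ineq hU hM).trans (IsBigO.of_bound 1 ?_)
  filter_upwards [eventually_ge_atTop (Real.exp 1)] with s hs
  rw [Real.norm_eq_abs, Real.norm_eq_abs, Real.abs_exp, Real.abs_exp, one_mul, Real.exp_le_exp,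
    neg_le_neg_iff]
  have hs0 : 0 < s := (Real.exp_pos 1).trans_le hs
  have h1 : 1 ≤ Real.log s := by
    rw [← Real.log_exp 1]; exact Real.log_le_log (Real.exp_pos 1) hs
  nlinarith

end Literature.NumberTheory.Sieve
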